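import Mathlib
import Summits.ResolutionOfSingularities.ResolutionOfSingularities.Theorems.RadicialJungCleanModelsCleanTauTwoSlice
import Summits.ResolutionOfSingularities.ResolutionOfSingularities.Theorems.RadicialJungCleanModelsCleanDimTwoSlice
import Summits.ResolutionOfSingularities.ResolutionOfSingularities.Theorems.RadicialJungCleanModelsCleanPermissibleSeq
import Summits.ResolutionOfSingularities.ResolutionOfSingularities.Theorems.FrobeniusLadderFInjectiveMacaulayficationProp44Invariants
import Summits.ResolutionOfSingularities.ResolutionOfSingularities.Theorems.FrobeniusLadderFInjectiveMacaulayficationProp44InvariantsDim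
import Summits.ResolutionOfSingularities.ResolutionOfSingularities.Theorems.FrobeniusLadderFInjectiveMacaulayficationProp44OfOrderReducible
import HarnessLib

/-!
# Route `RadicialJung`, crux `CleanModels` (stmt-ResolutionOfSingularities-15917), line `Sketch` rev 35, stub 6 `stub_cleanProp44` (X44c):
# THE CLEAN ASSEMBLY — X44c from THREE named residual slices (clean reach-tidy, clean `τ = 1` point slice, clean regular-curve slice)

Work item (W5) of the memo `Cruxes/CleanModels/Lines/Sketch-memo-4e-cleanPermissible.md` §7: the clean twin of the tree's sorry-free assembly
✓ `CP2008Prop44.cossartPiltant2008_prop44_holds` (`FrobeniusLadderFInjectiveMacaulayficationProp44Assembly.lean`: reach a tidy stage, carry the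
invariants, settle each piece relative to the complement of the others, patch, compose), written in the output currency of X44c and PROVED MODULO
EXACTLY THE THREE PIECES WHERE CURVES ARE BLOWN UP (memo 4e §4 (a)(a′)(b): the births (B′)/(B5′) live there), which enter as hypotheses with kernel
signatures:

* `hreach` — CLEAN REACH-TIDY: the binders of ✓ `CP2008Prop44.stub_reach` plus the clean data (`char K(X) = p`, the line of `G` clean-regular at
  every point), conclusion: a CLEAN-permissible sequence to a tidy stage (pieces of the four kinds, verbatim).
* `htauOne` — CLEAN `τ = 1` ISOLATED-POINT SLICE: the binders of ✓ `CP2008Prop44.stub_tauOne_point` plus the clean data, conclusion: the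
  conclusion of X44c on the open `V`.
* `hcurve` — CLEAN REGULAR-CURVE SLICE: the binders of ✓ `CP2008Prop44.stub_curve` WITHOUT the `τ = 1`-somewhere restriction (in the clean world
  the `τ ≥ 2` curve is not free either: the curve itself is blown up), plus the clean data, conclusion: the conclusion of X44c on `V`.

Everything else is kernel-checked here: the invariants at the tidy stage (✓ `CP2008Prop44.prop44Invariants_stage` over the forgetful map
✓ `isPermissibleBlowupSeq_of_isPermissibleSeq ∘ IsCleanPermissibleSeq.isPermissibleSeq`), clean-regularity of the line upstairs
(✓ `IsCleanPermissibleSeq.cleanRegAt`), the two ISOLATED-POINT slices (✓ `exists_isCleanPermissibleSeq_lt_comap_of_isolated_two_le_tau`,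
✓ `exists_isCleanPermissibleSeq_lt_comap_of_isolated_coheight_two`), CLEAN PATCHING (✓ `exists_isCleanPermissibleSeq_lt_of_pieces`) and composition
(✓ `IsCleanPermissibleSeq.comp`).

* `cleanProp44_of_cleanPieces` — **`hreach → htauOne → hcurve →` the statement of `stub_cleanProp44` VERBATIM.**

Honest framing: OURS; the three hypotheses are NOT proved here (they are the research residual of X44c: memo 4e §2.4–2.6, (B′) settled by hand for
perfect residue fields, (B5′) open); nothing here proves X44c, any case of `CleanModels`, or resolution of singularities in characteristic `p`.
-/

noncomputable section

set_option linter.dupNamespace false -- mandated namespace of this single-conjunct summit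

open CategoryTheory CategoryTheory.Limits AlgebraicGeometry TopologicalSpace IsLocalRing
open Literature.AlgebraicGeometry.Resolution Literature.AlgebraicGeometry.Motives
open Scheme.IdealSheafData

namespace Summit.ResolutionOfSingularities.ResolutionOfSingularities.Theorems.RadicialJung.CleanModels

/-- In the situation of `exists_isCleanPermissibleSeq_lt_of_pieces`: a point of order `≥ m` lies in `Z i` or outside `V i`. [folklore] -/
private theorem mem_or_not_mem_of_cover {X : Scheme.{0}} {J : X.IdealSheafData} {m : ℕ} {n : ℕ} {Z : Fin n → Set X}
    (hcov : ∀ z : X, (m : ℕ∞) ≤ idealOrder J z → ∃ i, z ∈ Z i) (i : Fin n) (V : X.Opens)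
    (hV : (V : Set X) = (⋃ j ∈ {j : Fin n | j ≠ i}, Z j)ᶜ) (z : X) (hz : (m : ℕ∞) ≤ idealOrder J z) :
    z ∈ Z i ∨ z ∉ (V : Set X) := by
  obtain ⟨j, hj⟩ := hcov z hz
  by_cases hji : j = i
  · exact Or.inl (hji ▸ hj)
  · right
    rw [hV, Set.mem_compl_iff, not_not]
    exact Set.mem_iUnion₂.mpr ⟨j, hji, hj⟩

/-- A piece contained in `V i`. [folklore] -/
private theorem subset_of_cover {X : Scheme.{0}} {n : ℕ} {Z : Fin n → Set X} (hdisj : ∀ i j, i ≠ j → Disjoint (Z i) (Z j))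
    (i : Fin n) (V : X.Opens) (hV : (V : Set X) = (⋃ j ∈ {j : Fin n | j ≠ i}, Z j)ᶜ) : Z i ⊆ (V : Set X) := by
  intro z hz
  rw [hV, Set.mem_compl_iff, Set.mem_iUnion₂]
  rintro ⟨j, hj, hzj⟩
  exact Set.disjoint_left.mp (hdisj i j (Ne.symm hj)) hz hzj

set_option maxHeartbeats 800000 in
-- the binder lists of the three hypotheses and of X44c are long (as in the tree's `cossartPiltant2008_prop44_holds`)
/-- **THE CLEAN ASSEMBLY: X44c (`stub_cleanProp44`, verbatim) from clean reach-tidy, the clean `τ = 1` isolated-point slice and the clean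
regular-curve slice.**  See the module docstring. [cite: CossartPiltant2008, Prop. 4.4] [cite: Piltant2013, Prop. 5.1 (proof, Step 2)] -/
theorem cleanProp44_of_cleanPieces
    (hreach : ∀ (p : ℕ), p.Prime → ∀ {X : Scheme.{0}} [IsIntegral X] [IsNoetherian X], CharP X.functionField p →
      ∀ (hX : Scheme.IsRegular X), Scheme.IsQuasiExcellent X → topologicalKrullDim X ≤ 3 →
      ∀ (G : X.functionField), (∀ x : X, CleanRegAt p (algebraMap (X.presheaf.stalk x) X.functionField) G) →
      ∀ (J : X.IdealSheafData) {μ : ℕ}, 1 ≤ μ → (∀ z, idealOrder J z ≤ μ) → (∀ z ∈ J.support, 1 < Order.coheight z) →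
      ∃ (X₁ : Scheme.{0}) (Φ : X₁ ⟶ X) (_ : IsIntegral X₁) (_ : IsDominant Φ) (J₁ : X₁.IdealSheafData)
        (_ : IsCleanPermissibleSeq p Φ J μ J₁ G) (n : ℕ) (Z : Fin n → Set X₁),
        (∀ i, IsClosed (Z i)) ∧ (∀ i j, i ≠ j → Disjoint (Z i) (Z j)) ∧
        (∀ z : X₁, (μ : ℕ∞) ≤ idealOrder J₁ z → ∃ i, z ∈ Z i) ∧
        ∀ i, (∃ x : X₁, Z i = {x} ∧ idealOrder J₁ x = μ ∧ (maximalIdeal (X₁.presheaf.stalk x)).spanFinrank = 3 ∧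
                ∀ hr : IsRegularLocalRing (X₁.presheaf.stalk x), 2 ≤ @stalkTau X₁ J₁ x hr μ) ∨
             (∃ x : X₁, Z i = {x} ∧ idealOrder J₁ x = μ ∧ (maximalIdeal (X₁.presheaf.stalk x)).spanFinrank = 3 ∧
                ∀ hr : IsRegularLocalRing (X₁.presheaf.stalk x), @stalkTau X₁ J₁ x hr μ = 1) ∨
             (∃ x : X₁, Z i = {x} ∧ idealOrder J₁ x = μ ∧ Order.coheight x = 2) ∨
             (∃ Y : Closeds X₁, Z i = (Y : Set X₁) ∧ Scheme.IsRegular (vanishingIdeal Y).subscheme ∧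
                IsIrreducible (Y : Set X₁) ∧ (∀ y ∈ (Y : Set X₁), idealOrder J₁ y = μ) ∧
                ∀ y ∈ (Y : Set X₁), ∀ hr : IsRegularLocalRing (X₁.presheaf.stalk y),
                  ∃ c : Fin 2 → X₁.presheaf.stalk y, @IsRsopPart _ _ _ 2 c ∧
                    Ideal.span (Set.range c) = stalkIdeal (vanishingIdeal Y) y))
    (htauOne : ∀ (p : ℕ), p.Prime → ∀ {X : Scheme.{0}} [IsIntegral X] [IsNoetherian X], CharP X.functionField p →
      ∀ (hX : Scheme.IsRegular X), Scheme.IsQuasiExcellent X → topologicalKrullDim X ≤ 3 →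
      ∀ (G : X.functionField), (∀ x : X, CleanRegAt p (algebraMap (X.presheaf.stalk x) X.functionField) G) →
      ∀ (J : X.IdealSheafData) {m : ℕ}, 1 ≤ m → (∀ z, idealOrder J z ≤ m) → (∀ z ∈ J.support, 1 < Order.coheight z) →
      ∀ (V : X.Opens) (x : X), x ∈ V → ∀ (hcl : IsClosed ({x} : Set X)),
      (∀ z : X, (m : ℕ∞) ≤ idealOrder J z → z = x ∨ z ∉ (V : Set X)) → idealOrder J x = m →
      (maximalIdeal (X.presheaf.stalk x)).spanFinrank = 3 → (haveI := hX x; stalkTau J x m = 1) → IsGRing (X.presheaf.stalk x) →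
      ∀ [IsIntegral ((V : X.Opens) : Scheme.{0})] [IsDominant V.ι],
      ∃ (V' : Scheme.{0}) (π : V' ⟶ V) (_ : IsIntegral V') (_ : IsDominant π) (K' : V'.IdealSheafData),
        IsCleanPermissibleSeq p π (J.comap V.ι) m K' (RatFn.functionFieldMap V.ι G) ∧ ∀ y, idealOrder K' y < m)
    (hcurve : ∀ (p : ℕ), p.Prime → ∀ {X : Scheme.{0}} [IsIntegral X] [IsNoetherian X], CharP X.functionField p →
      ∀ (hX : Scheme.IsRegular X), Scheme.IsQuasiExcellent X → topologicalKrullDim X ≤ 3 →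
      ∀ (G : X.functionField), (∀ x : X, CleanRegAt p (algebraMap (X.presheaf.stalk x) X.functionField) G) →
      ∀ (J : X.IdealSheafData) {m : ℕ}, 1 ≤ m → (∀ z, idealOrder J z ≤ m) → (∀ z ∈ J.support, 1 < Order.coheight z) →
      ∀ (V : X.Opens) (Y : Closeds X), Scheme.IsRegular (vanishingIdeal Y).subscheme → IsIrreducible (Y : Set X) →
      (Y : Set X) ⊆ (V : Set X) → (∀ z : X, (m : ℕ∞) ≤ idealOrder J z → z ∈ (Y : Set X) ∨ z ∉ (V : Set X)) →
      (∀ y ∈ (Y : Set X), idealOrder J y = m) →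
      (∀ y ∈ (Y : Set X), haveI := hX y; ∃ c : Fin 2 → X.presheaf.stalk y, IsRsopPart c ∧
        Ideal.span (Set.range c) = stalkIdeal (vanishingIdeal Y) y) →
      ∀ [IsIntegral ((V : X.Opens) : Scheme.{0})] [IsDominant V.ι],
      ∃ (V' : Scheme.{0}) (π : V' ⟶ V) (_ : IsIntegral V') (_ : IsDominant π) (K' : V'.IdealSheafData),
        IsCleanPermissibleSeq p π (J.comap V.ι) m K' (RatFn.functionFieldMap V.ι G) ∧ ∀ y, idealOrder K' y < m) :
    ∀ (p : ℕ), p.Prime → ∀ (S : Scheme.{0}) [IsIntegral S] [IsNoetherian S],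
      CharP S.functionField p → Scheme.IsRegular S → Scheme.IsExcellent S → topologicalKrullDim S = 3 →
      ∀ G₀ : S.functionField, (∀ s : S, CleanRegAt p (algebraMap (S.presheaf.stalk s) S.functionField) G₀) →
      ∀ I : S.IdealSheafData, I ≠ ⊥ →
      ∀ (X : Scheme.{0}) (ρ : X ⟶ S) [IsIntegral X] [IsNoetherian X] [IsDominant ρ],
        IsCleanRegularCentreBlowupSeq p ρ I G₀ →
        (∀ x : X, CleanRegAt p (algebraMap (X.presheaf.stalk x) X.functionField) (RatFn.functionFieldMap ρ G₀)) →
        ∀ (J : X.IdealSheafData) (μ : ℕ), 1 ≤ μ →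
          (∀ x ∈ J.support, 1 < Order.coheight x) → (∀ x, idealOrder J x ≤ μ) → (∃ x, idealOrder J x = μ) →
          ∃ (X' : Scheme.{0}) (π : X' ⟶ X) (_ : IsIntegral X') (_ : IsDominant π) (J' : X'.IdealSheafData),
            IsCleanPermissibleSeq p π J μ J' (RatFn.functionFieldMap ρ G₀) ∧ ∀ x, idealOrder J' x < μ := by
  intro p hp S _ _ hchar hS hexc hdimS G₀ _ I _ X ρ _ _ _ hρ hG J μ hμ hcodim hle _
  have hρ' : IsRegularCentreBlowupSeq ρ I := hρ.isRegularCentreBlowupSeq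
  have hX : Scheme.IsRegular X := hρ'.isRegular hS
  have hqe : Scheme.IsQuasiExcellent X := hρ'.isQuasiExcellent hexc
  have hX3 : topologicalKrullDim X ≤ 3 := CP2008Prop44.topologicalKrullDim_stage_le hρ' inferInstance (n := 3) hdimS.le
  haveI hcharX : CharP X.functionField p := charP_of_injective_ringHom (RatFn.functionFieldMap ρ).injective p
  set G : X.functionField := RatFn.functionFieldMap ρ G₀ with hGdef
  -- reach a tidy stage by a CLEAN-permissible sequence
  obtain ⟨X₁, Φ, hint₁', hΦ, J₁, hseq, n, Z, hZc, hdisj, hcov, hkind⟩ := hreach p hp hcharX hX hqe hX3 G hG J hμ hle hcodim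
  haveI := hint₁'
  haveI := hΦ
  -- the invariants at the tidy stage (over the forgetful map to the W4.6 currency)
  have hseqW : CampaignW46.IsPermissibleBlowupSeq J μ Φ J₁ :=
    CP2008Prop44.isPermissibleBlowupSeq_of_isPermissibleSeq hseq.isPermissibleSeq
  obtain ⟨-, hnoeth₁, hX₁, hqe₁, hle₁, hcodim₁, hG₁⟩ :=
    CP2008Prop44.prop44Invariants_stage S hS hexc I X ρ hρ' J μ hμ hcodim hle hseqW
  have hX3₁ : topologicalKrullDim X₁ ≤ 3 := CP2008Prop44.prop44Invariants_stage_dim hρ' (n := 3) hdimS.le hseqW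
  haveI := hnoeth₁
  haveI hcharX₁ : CharP X₁.functionField p := charP_of_injective_ringHom (RatFn.functionFieldMap Φ).injective p
  -- the line stays clean-regular at every point of the tidy stage
  have hG₁' : ∀ x : X₁, CleanRegAt p (algebraMap (X₁.presheaf.stalk x) X₁.functionField) (RatFn.functionFieldMap Φ G) :=
    hseq.cleanRegAt hp hcharX hG
  -- settle each piece relative to the complement of the others, and patch
  have hred : ∃ (X' : Scheme.{0}) (π : X' ⟶ X₁) (_ : IsIntegral X') (_ : IsDominant π) (J' : X'.IdealSheafData),
      IsCleanPermissibleSeq p π J₁ μ J' (RatFn.functionFieldMap Φ G) ∧ ∀ x, idealOrder J' x < μ := by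
    refine exists_isCleanPermissibleSeq_lt_of_pieces J₁ μ (RatFn.functionFieldMap Φ G) Z hZc hdisj hcov fun i V hV => ?_
    intro hVint hVdom
    have hbad := mem_or_not_mem_of_cover hcov i V hV
    have hZV := subset_of_cover hdisj i V hV
    rcases hkind i with ⟨x, hZ, hord, hdim, hτ⟩ | ⟨x, hZ, hord, hdim, hτ⟩ | ⟨x, hZ, hord, hcoh⟩ | ⟨Y, hZ, hreg, hirr, hordY, hcurveY⟩
    · -- τ ≥ 2 threefold point: the CLEAN isolated τ ≥ 2 branch (✓ `…CleanTauTwoSlice`)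
      have hxV : x ∈ V := hZV (by rw [hZ]; exact Set.mem_singleton x)
      have hcl : IsClosed ({x} : Set X₁) := hZ ▸ hZc i
      exact exists_isCleanPermissibleSeq_lt_comap_of_isolated_two_le_tau hp hX₁ J₁ hμ (RatFn.functionFieldMap Φ G) hG₁' V x hxV hcl
        (fun z hz => (hbad z hz).imp (fun h => by rw [hZ] at h; exact h) id) hord hdim (hτ (hX₁ x)) (hG₁ x)
    · -- τ = 1 threefold point: HYPOTHESIS `htauOne`
      have hxV : x ∈ V := hZV (by rw [hZ]; exact Set.mem_singleton x)
      have hcl : IsClosed ({x} : Set X₁) := hZ ▸ hZc i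
      exact htauOne p hp hcharX₁ hX₁ hqe₁ hX3₁ (RatFn.functionFieldMap Φ G) hG₁' J₁ hμ hle₁ hcodim₁ V x hxV hcl
        (fun z hz => (hbad z hz).imp (fun h => by rw [hZ] at h; exact h) id) hord hdim (hτ (hX₁ x)) (hG₁ x)
    · -- coheight-2 point: the CLEAN local-dimension-two branch (✓ `…CleanDimTwoSlice`)
      have hxV : x ∈ V := hZV (by rw [hZ]; exact Set.mem_singleton x)
      have hcl : IsClosed ({x} : Set X₁) := hZ ▸ hZc i
      exact exists_isCleanPermissibleSeq_lt_comap_of_isolated_coheight_two hp hX₁ J₁ hμ hle₁ hcodim₁ (RatFn.functionFieldMap Φ G) hG₁'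
        V x hxV hcl (fun z hz => (hbad z hz).imp (fun h => by rw [hZ] at h; exact h) id) hord hcoh
    · -- regular curve: HYPOTHESIS `hcurve`
      exact hcurve p hp hcharX₁ hX₁ hqe₁ hX3₁ (RatFn.functionFieldMap Φ G) hG₁' J₁ hμ hle₁ hcodim₁ V Y hreg hirr (hZ ▸ hZV)
        (fun z hz => (hbad z hz).imp (fun h => by rw [hZ] at h; exact h) id) hordY (fun y hy => hcurveY y hy (hX₁ y))
  -- compose with the reach sequence
  obtain ⟨X', π, hX', hπ, J', hseq', hlt⟩ := hred
  haveI := hX'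
  haveI := hπ
  exact ⟨X', π ≫ Φ, inferInstance, inferInstance, J', hseq.comp hseq' rfl, hlt⟩

end Summit.ResolutionOfSingularities.ResolutionOfSingularities.Theorems.RadicialJung.CleanModels

end
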